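import Summits.Ventures.PercRepro.SevenThreeCircuit

/-!
# PercRepro — the `(7,3)` cell: denominators of the witnesses of nullity `0` and `1` (p3, gen 15)

The share of a `3`-point flat `T` in a witness `S = T ∪ X` under the `θ = 6` rule is `1/D(S)`, and `D(S)` depends only
on the restriction `M|S` (`SevenThreePhi.lean`: `D(S) = Φ_3(S)`). This file evaluates it for the two simplest restrictions:
* `S` independent (nullity `0`): every `3`-subset is a flat, `D(S) = C(|S|, 3)` (`D_of_indep`);
* `S` of nullity `1` (`ρ(S) + 1 = |S|`): `S` contains a circuit `C` and every point of `S ∖ C` is a coloop of `M|S`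
  (`exists_circuit_of_nullity_one`), so by the coloop direct sum `D(S) = Σ_j C(|S ∖ C|, j)·Φ_{3−j}(C)`
  (`D_of_nullity_one`) — Lemma 24.1 of `MINE2-RLS.md` in its three closed forms by the size `c` of the circuit, with
  `y = |S| − c` coloops: `c = 3`: `6y + 3·C(y,2) + C(y,3)`; `c = 4`: `6 + 6y + 4·C(y,2) + C(y,3)`; `c ≥ 5`: `C(|S|, 3)`
  (the generic value, by Vandermonde) — `D_of_nullity_one_three` / `_four` / `_ge_five`.
(`P3-C025-seven-three-plan.md` §6, M3, the nullity-`0`/`1` half; nullity `2` is the series-class module M4.)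
-/

namespace PercRepro

namespace SevenThree

open Finset ThmH SixThree

variable {α : Type*} [DecidableEq α] {M : Matroid α} [M.Finite]

/-- The rank-`r` flats of an independent set are its `r`-subsets. -/
theorem flatsRestr_of_indep {S : Finset α} (hS : M.Indep (S : Set α)) (r : ℕ) :
    flatsRestr M S r = S.powersetCard r := by
  ext F
  rw [mem_flatsRestr, Finset.mem_powersetCard]
  constructor
  · rintro ⟨hFS, hFr, -⟩
    refine ⟨hFS, ?_⟩
    have hind : M.Indep (F : Set α) := hS.subset (Finset.coe_subset.2 hFS)
    rw [hind.eRk_eq_encard, Set.encard_coe_eq_coe_finsetCard] at hFr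
    exact_mod_cast hFr
  · rintro ⟨hFS, hcard⟩
    have hind : M.Indep (F : Set α) := hS.subset (Finset.coe_subset.2 hFS)
    refine ⟨hFS, by rw [hind.eRk_eq_encard, Set.encard_coe_eq_coe_finsetCard, hcard], ?_⟩
    intro e heS heF
    have hind' : M.Indep ((insert e F : Finset α) : Set α) :=
      hS.subset (Finset.coe_subset.2 (Finset.insert_subset heS hFS))
    rw [hind'.eRk_eq_encard, Set.encard_coe_eq_coe_finsetCard, Finset.card_insert_of_notMem heF, hcard]

/-- `Φ_r(S) = C(|S|, r)` for an independent set `S`. -/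
theorem Phi_of_indep {S : Finset α} (hS : M.Indep (S : Set α)) (r : ℕ) :
    Phi M r S = ((S.card.choose r : ℕ) : ℚ) := by
  unfold Phi
  rw [flatsRestr_of_indep hS r]
  rw [Finset.sum_congr rfl (fun F hF => by
    rw [(Finset.mem_powersetCard.1 hF).2, Nat.sub_self, pow_zero])]
  rw [Finset.sum_const, Finset.card_powersetCard]
  simp

/-- **The denominator of an independent witness** is the generic value `C(|S|, 3)`. -/
theorem D_of_indep {S : Finset α} (hS : M.Indep (S : Set α)) : D M S = ((S.card.choose 3 : ℕ) : ℚ) := by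
  have hSg : S ⊆ gr M := by
    rw [← Finset.coe_subset, coe_gr]
    exact hS.subset_ground
  rw [D_eq_Phi_three hSg, Phi_of_indep hS 3]

/-- **Nullity one**: a set `S ⊆ E` with `ρ(S) + 1 = |S|` contains a circuit `C`, and every point of `S ∖ C` lies
outside the closure of the rest of `S` (it is a coloop of `M|S`). -/
theorem exists_circuit_of_nullity_one {S : Finset α} (hS : S ⊆ gr M)
    (h : M.eRk (S : Set α) + 1 = (S.card : ℕ∞)) :
    ∃ C : Finset α, C ⊆ S ∧ M.IsCircuit (C : Set α) ∧
      ∀ y ∈ S, y ∉ C → y ∉ M.closure ((S.erase y : Finset α) : Set α) := by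
  classical
  have hSE : (S : Set α) ⊆ M.E := by rw [← coe_gr M]; exact_mod_cast hS
  have hdep : M.Dep (S : Set α) := by
    rw [Matroid.dep_iff]
    refine ⟨fun hind => ?_, hSE⟩
    rw [hind.eRk_eq_encard, Set.encard_coe_eq_coe_finsetCard] at h
    have h' : S.card + 1 = S.card := by exact_mod_cast h
    omega
  obtain ⟨C, hCS, hC⟩ := hdep.exists_isCircuit_subset
  have hCfin : ((S.filter (fun e => e ∈ C) : Finset α) : Set α) = C := by
    ext e
    simp only [Finset.coe_filter, Set.mem_setOf_eq]
    exact ⟨fun he => he.2, fun he => ⟨Finset.mem_coe.1 (hCS he), he⟩⟩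
  refine ⟨S.filter (fun e => e ∈ C), Finset.filter_subset _ _, by rw [hCfin]; exact hC, ?_⟩
  intro y hyS hyC hycl
  have hyC' : y ∉ C := fun hh => hyC (Finset.mem_filter.2 ⟨hyS, hh⟩)
  have hsub : C ⊆ ((S.erase y : Finset α) : Set α) := by
    intro e he
    rw [Finset.coe_erase]
    exact ⟨hCS he, fun hey => hyC' (hey ▸ he)⟩
  have hEr : ((S.erase y : Finset α) : Set α) ⊆ M.E := (Finset.coe_subset.2 (Finset.erase_subset _ _)).trans hSE
  have hdep' : M.Dep ((S.erase y : Finset α) : Set α) := hC.dep.superset hsub hEr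
  have hlt : M.eRk ((S.erase y : Finset α) : Set α) < ((S.erase y).card : ℕ∞) := by
    have := Matroid.eRk_lt_encard_of_dep_of_finite (Finset.finite_toSet _) hdep'
    rwa [Set.encard_coe_eq_coe_finsetCard] at this
  have heq : M.eRk ((insert y (S.erase y) : Finset α) : Set α) = M.eRk ((S.erase y : Finset α) : Set α) :=
    eRk_insert_eq_of_mem_closure ((Finset.erase_subset _ _).trans hS) hycl
  rw [Finset.insert_erase hyS] at heq
  rw [heq] at h
  rw [Finset.card_erase_of_mem hyS] at hlt
  obtain ⟨k, hk, -⟩ := ThmH.eRk_eq_nat M (S.erase y)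
  rw [hk] at hlt h
  have h1 : k < S.card - 1 := by exact_mod_cast hlt
  have h2 : ((k + 1 : ℕ) : ℕ∞) = (S.card : ℕ∞) := by rw [Nat.cast_succ]; exact h
  have h3 : k + 1 = S.card := by exact_mod_cast h2
  omega

/-- **The denominator of a nullity-one witness** is the coloop direct sum over its circuit `C`:
`D(S) = Σ_{j ≤ 3} C(|S ∖ C|, j)·Φ_{3−j}(C)`. -/
theorem D_of_nullity_one {S C : Finset α} (hS : S ⊆ gr M) (hCS : C ⊆ S) (hC : M.IsCircuit (C : Set α))
    (hcol : ∀ y ∈ S, y ∉ C → y ∉ M.closure ((S.erase y : Finset α) : Set α)) :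
    D M S = ∑ j ∈ Finset.range 4, (((S \ C).card.choose j : ℕ) : ℚ) * Phi M (3 - j) C := by
  have hunion : C ∪ (S \ C) = S := Finset.union_sdiff_of_subset hCS
  have hcol' : ∀ y ∈ S \ C, y ∉ M.closure ((C ∪ (S \ C).erase y : Finset α) : Set α) := by
    intro y hy
    rw [Finset.mem_sdiff] at hy
    have : C ∪ (S \ C).erase y = S.erase y := by
      ext e
      simp only [Finset.mem_union, Finset.mem_erase, Finset.mem_sdiff]
      constructor
      · rintro (heC | ⟨hey, heS, -⟩)
        · exact ⟨fun hey => hy.2 (hey ▸ heC), hCS heC⟩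
        · exact ⟨hey, heS⟩
      · rintro ⟨hey, heS⟩
        by_cases heC : e ∈ C
        · exact Or.inl heC
        · exact Or.inr ⟨hey, heS, heC⟩
    rw [this]
    exact hcol y hy.1 hy.2
  conv_lhs => rw [← hunion]
  exact D_circuit_union_coloops hC (S \ C) (Finset.sdiff_subset.trans hS) hcol'

/-- `Φ_r(C)` for a `3`-circuit: `1, 3, 6, 0` at `r = 0, 1, 2, 3`. -/
theorem Phi_three_circuit {C : Finset α} (hC : M.IsCircuit (C : Set α)) (h3 : C.card = 3) :
    Phi M 0 C = 1 ∧ Phi M 1 C = 3 ∧ Phi M 2 C = 6 ∧ Phi M 3 C = 0 := by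
  refine ⟨?_, ?_, ?_, ?_⟩
  · rw [Phi_isCircuit_of_le hC (by omega), h3]; norm_num
  · rw [Phi_isCircuit_of_le hC (by omega), h3]; norm_num
  · have := Phi_isCircuit_top hC
    rwa [h3] at this
  · exact Phi_isCircuit_of_ge hC (by omega)

/-- `Φ_r(C)` for a `4`-circuit: `1, 4, 6, 6` at `r = 0, 1, 2, 3`. -/
theorem Phi_four_circuit {C : Finset α} (hC : M.IsCircuit (C : Set α)) (h4 : C.card = 4) :
    Phi M 0 C = 1 ∧ Phi M 1 C = 4 ∧ Phi M 2 C = 6 ∧ Phi M 3 C = 6 := by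
  refine ⟨?_, ?_, ?_, ?_⟩
  · rw [Phi_isCircuit_of_le hC (by omega), h4]; norm_num
  · rw [Phi_isCircuit_of_le hC (by omega), h4]; norm_num
  · rw [Phi_isCircuit_of_le hC (by omega), h4]; norm_num [Nat.choose_two_right]
  · have := Phi_isCircuit_top hC
    rwa [h4] at this

/-- **Lemma 24.1, `c = 3`**: a witness of nullity one with a `3`-circuit and `y` coloops has
`D(S) = 6y + 3·C(y,2) + C(y,3)`. -/
theorem D_of_nullity_one_three {S C : Finset α} (hS : S ⊆ gr M) (hCS : C ⊆ S) (hC : M.IsCircuit (C : Set α))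
    (h3 : C.card = 3) (hcol : ∀ y ∈ S, y ∉ C → y ∉ M.closure ((S.erase y : Finset α) : Set α)) :
    D M S = 6 * ((S \ C).card : ℚ) + 3 * (((S \ C).card.choose 2 : ℕ) : ℚ) + (((S \ C).card.choose 3 : ℕ) : ℚ) := by
  rw [D_of_nullity_one hS hCS hC hcol]
  obtain ⟨h0, h1, h2, h3'⟩ := Phi_three_circuit hC h3
  simp only [Finset.sum_range_succ, Finset.sum_range_zero]
  norm_num [h0, h1, h2, h3']
  ring

/-- **Lemma 24.1, `c = 4`**: a witness of nullity one with a `4`-circuit and `y` coloops has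
`D(S) = 6 + 6y + 4·C(y,2) + C(y,3)`. -/
theorem D_of_nullity_one_four {S C : Finset α} (hS : S ⊆ gr M) (hCS : C ⊆ S) (hC : M.IsCircuit (C : Set α))
    (h4 : C.card = 4) (hcol : ∀ y ∈ S, y ∉ C → y ∉ M.closure ((S.erase y : Finset α) : Set α)) :
    D M S = 6 + 6 * ((S \ C).card : ℚ) + 4 * (((S \ C).card.choose 2 : ℕ) : ℚ) +
      (((S \ C).card.choose 3 : ℕ) : ℚ) := by
  rw [D_of_nullity_one hS hCS hC hcol]
  obtain ⟨h0, h1, h2, h3'⟩ := Phi_four_circuit hC h4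
  simp only [Finset.sum_range_succ, Finset.sum_range_zero]
  norm_num [h0, h1, h2, h3']
  ring

/-- **Lemma 24.1, `c ≥ 5`**: a witness of nullity one whose circuit has at least `5` points has the generic
denominator `D(S) = C(|S|, 3)` (Vandermonde). -/
theorem D_of_nullity_one_ge_five {S C : Finset α} (hS : S ⊆ gr M) (hCS : C ⊆ S) (hC : M.IsCircuit (C : Set α))
    (h5 : 5 ≤ C.card) (hcol : ∀ y ∈ S, y ∉ C → y ∉ M.closure ((S.erase y : Finset α) : Set α)) :
    D M S = ((S.card.choose 3 : ℕ) : ℚ) := by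
  rw [D_of_nullity_one hS hCS hC hcol]
  have hPhi : ∀ j ∈ Finset.range 4, Phi M (3 - j) C = ((C.card.choose (3 - j) : ℕ) : ℚ) := by
    intro j hj
    rw [Finset.mem_range] at hj
    exact Phi_isCircuit_of_le hC (by omega)
  rw [Finset.sum_congr rfl (fun j hj => by rw [hPhi j hj])]
  have hcard : S.card = (S \ C).card + C.card := (Finset.card_sdiff_add_card_eq_card hCS).symm
  rw [hcard, Nat.add_choose_eq]
  push_cast
  rw [Finset.Nat.sum_antidiagonal_eq_sum_range_succ_mk]

end SevenThree

end PercRepro
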